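import Summits.AtomisticToContinuum.Crystallization.Theorems.ChargedEnergyGapWeightMaxCover
import HarnessLib

/-!
(SPLIT FOR THE 400-LINE CAP by the landing lane, hand-2 g29: this file = part A; part B = `…ChargedEnergyGapHarmonicTransfer` imports it; same namespace, all FQNs unchanged.)
# `ChargedEnergyGap` — the HARMONIC TRANSFER BOUND and the split of the budget far leaf by MODUS PONENS
LANDING BANNER (critic row 1115 (6); landing lane hand-2 g31): the (H𝄪)/(N𝄪)-type RECORD pieces of this lens-3 g53–g56 engine are VACUOUS at μ₀ > 0 — `harmStableWith_nonpos` (lens-3 g61, `…ChargedEnergyGapRotationGauge`); superseded by the …R designate ((H𝄪ʳ) `LocalSeamTransferBoundR`, (N𝄪ʳ) `LocalSeamReductionR` of `…ChargedEnergyGapRotationRepair`).  Landed as an ENGINE: the transfer / reduction lemmas below are consumed by P-I.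
# (cell `decomp-a2c`, lens 3, generation 53, node «HarmonicTransfer», part P-A; over part O-C `…Theorems.ChargedEnergyGapWeightMaxCover`)

WHAT THE BUDGET FAR LEAF STILL MIXES (memo g52 §3, memo g53 §1).  CB-FAR_W|cored,B₀ (`FarLabelledFloorCoredBudgetW`, part O-D) has two
named failure modes: (i) the first-order TRANSFER across the transition shell `{0 < W.far < 1}` — a shell-normal relaxation lowers the
weighted far account at first order through the third moment of `∇far`, and only the far share of the elastic energy holds it — must
cost at most `≈ c₁/(3B₀)` per shell site; (ii) the NONLINEAR-TO-HARMONIC and LOCAL-TO-GLOBAL reduction — Cauchy–Born on average with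
zero loss per plateau site, label-coherent reference patches, finite distortion between the strain scale `τ` and the labelling
tolerance `lam`, reference-stacking dipoles paid by the bulk excess of non-ground stackings, holes around gross matter paid by the
neighbourhood debit, long bonds, creases of the max cover.  Mode (i) is a CLOSED-FORM QUADRATIC PROGRAMME over periodic equilibria —
exactly the object the census instrument measures (C10/C11) — and it is typed here WITHOUT charts or displacement gauges: the reference
is an abstract periodic configuration `P` in force and stress equilibrium with a harmonic stability margin over affine-plus-periodic
fields, the weight is the max-cover PROFILE `(1 − smoothStep (2 − 2·dist(·, C)/ϱ))⁴` of an arbitrary `Λ_P`-invariant centre set `C`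
(for `C` = the core orbits this is `farWeightM`, part N-B) at the reference sites, holes are an arbitrary invariant excised set `X`
(free within `ϱ/8` of `C`, where the non-chartable core zones live, priced per site elsewhere), and the test objects are GLOBAL BOND
COCYCLES `β(y, z)` — relative displacements assigned to ordered pairs, antisymmetric, `Λ_P`-periodic and additive on ALL triangles,
i.e. exactly the bond fields `A(z − y) + v(z) − v(y)` of affine-plus-periodic displacements (homogeneous strain `A` included), of size
`≤ τ·dist` on every non-excised pair.  LOCAL cocycles (additive only on short non-excised triangles, which would represent the Burgers
monodromy of dislocated far regions) make the bound FALSE: their long bonds are free and the attractive tail pays `≈ 1.9·10⁻⁴` per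
PLATEAU site for `β = −τ·(z − y)·1[dist > 8]` (memo g53 §1, dead end 10) — so monodromy is NOT representable here and the dislocated
sector (cut surfaces with quantised jumps, fault ribbons of dissociated dislocations) is the reduction's IDEA-NEEDED part.

THE SPLIT (modus ponens; generic in the weight system `W`; dials `μ₀ τ λ C_T` new, `s lam ℓ ϱ c₁ ρ₀ B₀` of record):
  (H♭) HARM-TRANSFER♭(C_T)  `HarmonicTransferBoundC s lam ℓ μ₀ τ λ ϱ C_T`: for every admissible `(P, C, X, β)` the profile-weighted
                           harmonic model `Σ_{y ∉ X} w_C(y)·(l_y(β) + λ·q_y(β))` of the far account is at least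
                           `−C_T·#{shell sites} − C_H·#{priced excised sites}` (`C_H ≥ 0` existential, `C_T` the dial) — UNDECIDED →
                           TRUE-leaning at the record (planar harmonic optimum `3.85·10⁻⁸` per shell site at `λ = 1` for single-valued
                           fields, all 15 sampled Bloch sectors positive semi-definite, memo g53 §2; monodromy and priced holes only
                           add positive quadratic energy at zero stress; record `C_T = 1/(3·10⁶)`; census C11-29 measured `7.8·10⁻⁸`
                           per shell site on the hcp max-cover shell: margin `×4.3` at `λ = 1`, `×2.1` at `λ = 1/2`) · INSTRUMENTABLE
                           through its corollary (H) · ATTACKABLE-M (a weighted Korn / summation-by-parts inequality for lattice quadratic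
                           forms; blended-quasicontinuum ghost-force analyses are the nearest prior art);
  (H)  HARM-TRANSFER(C_T)   `HarmonicTransferBound …`: the same for `Λ_P`-PERIODIC displacement fields `u` (`β = δu`, no affine part) —
                           WEAKER than (H♭) (`harmonicTransferBound_of_cocycle`, proved): the census-facing KILL PATH (C10/C11 are
                           instances; ask C13); a refutation of (H) refutes (H♭);
  (N♭) HARM-REDUCTION_W    `HarmonicReductionW W …`: (H♭) ⟹ CB-FAR_W|cored,B₀ — WEAKER than the leaf (`harmonicReductionW_of_budget`),
                           carries mode (ii) entire · UNDECIDED (TRUE-leaning with the leaf for the max cover) · ATTACKABLE-L for far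
                           regions that are ONE periodic Barlow polytype up to trivial-monodromy elastic distortion and priced holes
                           (point-defect clusters, small loops inside their core zones: there (H♭) applies as a black box after the
                           Taylor step) · IDEA-NEEDED for the dislocated sector (monodromy, fault ribbons) and for reference switching
                           (grains, twins);
  glue (proved)            (H♭) ∧ (N♭) ⟹ CB-FAR_W|cored,B₀ (`farLabelledFloorCoredBudgetW_of_harmonic`, one line — a bridge split: (H♭)
                           is substantive and free of the summit's objects, neither piece gives the leaf alone).
WHY THIS IS NOVEL (memo g53 §4): the transfer term of a smoothly-weighted atomistic energy ACCOUNT is isolated as one uniform inequality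
for a quadratic programme over all stable periodic equilibria, all invariant centre sets, all priced excisions and all
affine-plus-periodic bond fields, with the shell-site count as the only extensive currency — blended-quasicontinuum blending estimates
bound a consistency error in a norm, not an energy account from below per shell site uniformly in the plateau size.

§1 The closed-form Lennard-Jones derivatives (★ certified against `lennardJones`), the profile weight, the harmonic model over bond
fields.  §2 Admissible references (separated, labelled, force-free, stress-free, stable over global cocycles), invariant sets, global
cocycles, strain; the three pieces; ★ (H♭) ⟹ (H); dials; glue; WEAKER; degenerate-instance sanity (`β ≡ 0`, `C = ∅`).  §3 Record
`(μ₀, τ, λ, C_T) = (1/100, 3/100, 1/2, 1/(3·10⁶))`: ★★ the ten-leaf cone for every `W`, ★★ the max-cover ten-leaf cone at `ϱ = 160`,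
the budget identity `C_T·B₀ = (2/3)·c₁`, the census number C11-29 per shell site.

TAGS.  HARM-TRANSFER♭(1/(3·10⁶)): UNDECIDED→TRUE-leaning · INSTRUMENTABLE (via (H): C10/C11/C13) · ATTACKABLE-M.  HARM-TRANSFER: WEAKER
than (H♭) (proved) · kill path.  HARM-REDUCTION_W: WEAKER than CB-FAR_W|cored,10⁵ (proved) · UNDECIDED · ATTACKABLE-L | IDEA-NEEDED
(reference switching).  No new EQUIV (the lineage's EQUIV of record stays the packing-end `farLabelledFloorCoredW_iff_budget_packing`
of part O-D). -/
noncomputable section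
open scoped Classical
open Literature.MathematicalPhysics.StatisticalMechanics
open Literature.Geometry.DiscreteGeometry
open Summit.AtomisticToContinuum.Crystallization.Theses.PricedLinkCensus
open Summit.AtomisticToContinuum.Crystallization.Theorems.ChargedEnergyGapNegative

namespace Summit.AtomisticToContinuum.Crystallization.Theorems.ChargedEnergyGapChartDial

/-! ## §1 Closed-form derivatives of the potential, the profile weight, the harmonic model -/

section Model

/-- `V′` of the Lennard-Jones potential in closed form: `V′(t) = −t⁻¹³ + t⁻⁷` (★ `hasDerivAt_lennardJones`). -/
def ljD1 (t : ℝ) : ℝ :=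
  -(t⁻¹) ^ 13 + (t⁻¹) ^ 7

/-- `V″` of the Lennard-Jones potential in closed form: `V″(t) = 13t⁻¹⁴ − 7t⁻⁸` (★ `hasDerivAt_ljD1`). -/
def ljD2 (t : ℝ) : ℝ :=
  13 * (t⁻¹) ^ 14 - 7 * (t⁻¹) ^ 8

/-- ★ CERTIFIED DICTIONARY, first derivative: away from `0`, `lennardJones` has derivative `ljD1`. -/
theorem hasDerivAt_lennardJones {t : ℝ} (ht : t ≠ 0) : HasDerivAt lennardJones (ljD1 t) t := by
  have h1 : HasDerivAt (fun r : ℝ => r⁻¹) (-(t ^ 2)⁻¹) t := hasDerivAt_inv ht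
  have h2 : HasDerivAt (fun r : ℝ => (r⁻¹) ^ 12) _ t := h1.pow 12
  have h3 : HasDerivAt (fun r : ℝ => (r⁻¹) ^ 6) _ t := h1.pow 6
  have h4 : HasDerivAt (fun r : ℝ => (1 / 12 : ℝ) * (r⁻¹) ^ 12 - (1 / 6 : ℝ) * (r⁻¹) ^ 6) _ t :=
    (h2.const_mul _).sub (h3.const_mul _)
  have hf : lennardJones = fun r : ℝ => (1 / 12 : ℝ) * (r⁻¹) ^ 12 - (1 / 6 : ℝ) * (r⁻¹) ^ 6 := by
    funext r; rfl
  rw [hf]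
  refine h4.congr_deriv ?_
  unfold ljD1
  norm_num
  field_simp

/-- ★ CERTIFIED DICTIONARY, second derivative: away from `0`, `ljD1` has derivative `ljD2`. -/
theorem hasDerivAt_ljD1 {t : ℝ} (ht : t ≠ 0) : HasDerivAt ljD1 (ljD2 t) t := by
  have h1 : HasDerivAt (fun r : ℝ => r⁻¹) (-(t ^ 2)⁻¹) t := hasDerivAt_inv ht
  have h2 : HasDerivAt (fun r : ℝ => (r⁻¹) ^ 13) _ t := h1.pow 13
  have h3 : HasDerivAt (fun r : ℝ => (r⁻¹) ^ 7) _ t := h1.pow 7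
  have h4 : HasDerivAt (fun r : ℝ => -(r⁻¹) ^ 13 + (r⁻¹) ^ 7) _ t := h2.neg.add h3
  have hf : ljD1 = fun r : ℝ => -(r⁻¹) ^ 13 + (r⁻¹) ^ 7 := by
    funext r; rfl
  rw [hf]
  refine h4.congr_deriv ?_
  unfold ljD2
  norm_num
  field_simp
  ring

/-- The **PROFILE WEIGHT** of a centre set `C` at scale `ϱ`: `(1 − smoothStep (2 − 2·dist(q, C)/ϱ))⁴` — `0` within `ϱ/2` of `C`, `1`
beyond `ϱ`, the max-cover profile in between (for `C` = the union of the core orbits this is `farWeightM`, part N-B). -/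
def profileWeight (ϱ : ℝ) (C : Set E3) (q : E3) : ℝ :=
  (1 - smoothStep (2 - 2 * Metric.infDist q C / ϱ)) ^ 4

/-- The profile weight is non-negative … -/
theorem profileWeight_nonneg (ϱ : ℝ) (C : Set E3) (q : E3) : 0 ≤ profileWeight ϱ C q :=
  pow_nonneg (sub_nonneg.2 (smoothStep_le_one _)) 4

/-- … and at most `1`. -/
theorem profileWeight_le_one (ϱ : ℝ) (C : Set E3) (q : E3) : profileWeight ϱ C q ≤ 1 := by
  have h0 : 0 ≤ 1 - smoothStep (2 - 2 * Metric.infDist q C / ϱ) := sub_nonneg.2 (smoothStep_le_one _)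
  have h1 : 1 - smoothStep (2 - 2 * Metric.infDist q C / ϱ) ≤ 1 := sub_le_self _ (smoothStep_nonneg _)
  exact pow_le_one₀ h0 h1

/-- Degenerate instance: with NO centres the profile weight vanishes identically (`dist(q, ∅) = 0` by the Mathlib convention). -/
theorem profileWeight_empty (ϱ : ℝ) (q : E3) : profileWeight ϱ ∅ q = 0 := by
  simp only [profileWeight, Metric.infDist_empty, mul_zero, zero_div, sub_zero]
  rw [smoothStep_of_one_le (by norm_num)]
  norm_num

/-- A BOND FIELD assigns a relative displacement `β y z` to the ordered pair `(y, z)`; the bond field of a displacement `u` is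
`δu (y, z) = u z − u y` (`fieldCocycle`). -/
def fieldCocycle (u : E3 → E3) : E3 → E3 → E3 :=
  fun y z => u z - u y

variable (β : E3 → E3 → E3)

/-- LINEAR bond term of the bond field `β` on the bond `y → z`: `V′(d)·⟪ê, β y z⟫`, `d = dist y z`, `ê = (z − y)/d`. -/
def bondLin (y z : E3) : ℝ :=
  ljD1 (dist y z) * inner ℝ ((dist y z)⁻¹ • (z - y)) (β y z)

/-- QUADRATIC bond term: `V″(d)·⟪ê, β⟫² + (V′(d)/d)·(‖β‖² − ⟪ê, β⟫²)` (longitudinal and transverse bond stiffnesses). -/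
def bondQuad (y z : E3) : ℝ :=
  ljD2 (dist y z) * inner ℝ ((dist y z)⁻¹ • (z - y)) (β y z) ^ 2 +
    ljD1 (dist y z) / dist y z * (‖β y z‖ ^ 2 - inner ℝ ((dist y z)⁻¹ • (z - y)) (β y z) ^ 2)

variable (P : PeriodicConfiguration 3) (X : Set E3)

/-- The LINEAR SITE TERM `l_y(β) = ½ Σ'_{z ∈ P ∖ X, z ≠ y} V′(d_yz)⟪ê_yz, β y z⟫` (half: each bond is shared by its two ends; a `tsum`,
absolutely convergent for separated `P` and `‖β y z‖ ≤ τ·dist y z`). -/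
def linSite (y : E3) : ℝ :=
  (1 / 2) * ∑' z : {z : E3 // z ∈ P.points ∧ z ∉ X ∧ z ≠ y}, bondLin β y (z : E3)

/-- The QUADRATIC SITE TERM `q_y(β) = ¼ Σ'_{z ∈ P ∖ X, z ≠ y} [V″⟪ê, β⟫² + (V′/d)(‖β‖² − ⟪ê, β⟫²)]` (`¼ = ½` pair Taylor
coefficient `× ½` bond sharing). -/
def quadSite (y : E3) : ℝ :=
  (1 / 4) * ∑' z : {z : E3 // z ∈ P.points ∧ z ∉ X ∧ z ≠ y}, bondQuad β y (z : E3)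

/-- The nearest-neighbour-range DIRICHLET SITE TERM `Σ'_{z ∈ P, z ≠ y, dist y z ≤ 2} ‖β y z‖²` (the currency of the stability margin). -/
def dirichletSite (y : E3) : ℝ :=
  ∑' z : {z : E3 // z ∈ P.points ∧ z ≠ y ∧ dist y z ≤ 2}, ‖β y (z : E3)‖ ^ 2

variable (lamQ ϱ : ℝ) (C : Set E3)

/-- The **PROFILE-WEIGHTED HARMONIC MODEL OF THE FAR ACCOUNT**: `Σ_{y ∈ motif ∖ X} w_C(y)·(l_y(β) + λ·q_y(β))` — profile weights at the
reference sites, quadratic part with the absorption dial `λ` (the anharmonic remainder of the reduction (N♭) eats the fraction `1 − λ`). -/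
def modelFar : ℝ :=
  ∑ y ∈ P.motif, if y ∈ X then 0 else profileWeight ϱ C y * (linSite β P X y + lamQ * quadSite β P X y)

/-- The MODEL SHELL COUNT: non-excised motif sites of profile weight strictly between `0` and `1`. -/
def modelShellCount : ℕ :=
  (P.motif.filter fun y => y ∉ X ∧ 0 < profileWeight ϱ C y ∧ profileWeight ϱ C y < 1).card

/-- The PRICED EXCISED COUNT: excised motif sites farther than `ϱ/8` from the centre set (excision within `ϱ/8` of `C` — the core zones,
at distance `≥ 3ϱ/8` from every weighted site — is free). -/
def pricedExcisedCount : ℕ :=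
  (P.motif.filter fun y => y ∈ X ∧ ϱ / 8 < Metric.infDist y C).card

/-- Degenerate instance: the ZERO BOND FIELD has zero model account (so (H♭) can only hold with `0 ≤ C_T·#shell + C_H·#priced`: an honest
lower bound, not a vacuous one). -/
theorem modelFar_zero_field : modelFar (fun _ _ => 0) P X lamQ ϱ C = 0 := by
  simp [modelFar, linSite, quadSite, bondLin, bondQuad]

/-- Degenerate instance: with NO centres the model account vanishes for every bond field (all weights are `0`) … -/
theorem modelFar_empty_centres : modelFar β P X lamQ ϱ ∅ = 0 := by
  simp [modelFar, profileWeight_empty]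

/-- … and so does the model shell count. -/
theorem modelShellCount_empty_centres : modelShellCount P X ϱ ∅ = 0 := by
  simp [modelShellCount, profileWeight_empty]

end Model

end Summit.AtomisticToContinuum.Crystallization.Theorems.ChargedEnergyGapChartDial

end
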